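import Mathlib

/-!
# Invariant forms: every left Jordan chain at `θ = −1` is orthogonal to the `(−1)`-eigenspace

Helper file for crux `stmt-CriticalPhenomena-4575` (`NoHeavyLowerTail`, route `PercNearOneGluingNoHeavy`), new-inequality factory
seat `prim-ineq-gen-3` (gen 31).  Everything here is PROVED; no definitions.  Imports Mathlib only.  Memo:
`run/shared/lean/prim/prim-ineq-gen-3/FINDINGS-gen31.md` §F31-3 and `PAPER-PRODUCTS.md` §3.

Abstract linear algebra behind CONJECTURE J at `θ = −1` for the Marica–Schönheim pencil `Z + θY` (rows of two matrices `Z, Y : ι → κ → R`).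
Call a kernel `F : κ → κ → R` INVARIANT if the two Gram forms agree: `∑_{e,e'} Z a e F e e' Z b e' = ∑_{e,e'} Y a e F e e' Y b e'` for all
rows `a, b` (`Z F Zᵀ = Y F Yᵀ =: G`).  If `(v₀, v₁)` is a left Jordan chain of length two at `−1` — `v₀ Z = v₀ Y` and `v₁ (Z − Y) = −v₀ Y`
column-wise — then `v₀` is `G`-orthogonal to EVERY `w` with `w Z = w Y`; in particular `v₀ G v₀ᵀ = 0`.  [Compute `v₁ G wᵀ` through `Z F Zᵀ` and
through `Y F Yᵀ`: the difference `((v₁Z − v₁Y) F (wZ)ᵀ) = −(v₀Y) F (wY)ᵀ = −v₀ G wᵀ` must vanish.]  Special cases: `F = δ_∅ δ_∅ᵀ` is the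
`∅`-criterion `∑ v₀ = 0` of `…ComplementPair`; `F = g gᵀ` with `g` a common column relation of `Z − Y` is the pairing criterion.  So a chain
at `−1` through `v₀` is impossible as soon as ONE invariant kernel has `v₀ G v₀ᵀ ≠ 0` (e.g. a positive definite invariant form over an
ordered field).

* `chain_orthogonal_of_invariant_form` — ★ the orthogonality `v₀ G wᵀ = 0` (any commutative ring).
* `no_chain_of_invariant_form_anisotropic` — if some invariant `F` has `v₀ G v₀ᵀ ≠ 0` then `(v₀, v₁)` is not a chain at `−1`.
(prim-ineq-gen-3 gen 31, 2026-08-26.)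
-/

namespace Summit.CriticalPhenomena.PercolationContinuityZ3.Theorems

namespace OrderedDifferences

open Finset

variable {ι κ R : Type*} [Fintype ι] [Fintype κ] [CommRing R]

/-- Reordering a fourfold sum: `∑_a ∑_b ∑_e ∑_e' = ∑_e ∑_e' ∑_a ∑_b`. -/
theorem sum_sum_sum_sum_comm (f : ι → ι → κ → κ → R) :
    ∑ a, ∑ b, ∑ e, ∑ e', f a b e e' = ∑ e, ∑ e', ∑ a, ∑ b, f a b e e' := by
  have h1 : ∑ a, ∑ b, ∑ e, ∑ e', f a b e e' = ∑ a, ∑ e, ∑ e', ∑ b, f a b e e' := by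
    refine sum_congr rfl fun a _ => ?_
    rw [Finset.sum_comm]
    exact sum_congr rfl fun e _ => Finset.sum_comm
  rw [h1, Finset.sum_comm]
  exact sum_congr rfl fun e _ => Finset.sum_comm

/-- Bilinear expansion: `x (Z F Wᵀ) yᵀ = (xZ) F (yW)ᵀ`. -/
theorem sum_sum_gram_eq (Z W : ι → κ → R) (F : κ → κ → R) (x y : ι → R) :
    ∑ a, ∑ b, x a * (∑ e, ∑ e', Z a e * F e e' * W b e') * y b =
      ∑ e, ∑ e', (∑ a, x a * Z a e) * F e e' * (∑ b, y b * W b e') := by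
  have lhs : ∑ a, ∑ b, x a * (∑ e, ∑ e', Z a e * F e e' * W b e') * y b =
      ∑ a, ∑ b, ∑ e, ∑ e', x a * Z a e * F e e' * (y b * W b e') := by
    refine sum_congr rfl fun a _ => sum_congr rfl fun b _ => ?_
    rw [mul_sum, sum_mul]
    refine sum_congr rfl fun e _ => ?_
    rw [mul_sum, sum_mul]
    refine sum_congr rfl fun e' _ => ?_
    ring
  have rhs : ∑ e, ∑ e', (∑ a, x a * Z a e) * F e e' * (∑ b, y b * W b e') =
      ∑ e, ∑ e', ∑ a, ∑ b, x a * Z a e * F e e' * (y b * W b e') := by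
    refine sum_congr rfl fun e _ => sum_congr rfl fun e' _ => ?_
    rw [sum_mul, sum_mul]
    refine sum_congr rfl fun a _ => ?_
    rw [mul_sum]
  rw [lhs, rhs, sum_sum_sum_sum_comm]

/-- **Chains at `−1` are orthogonal to the `(−1)`-eigenspace for every invariant form.**  Let `Z, Y : ι → κ → R` be two matrices (rows
indexed by `ι`, columns by `κ`) and `F : κ → κ → R` a kernel with `Z F Zᵀ = Y F Yᵀ` entrywise.  If `v₀ Z = v₀ Y` and `v₁ Z − v₁ Y = −v₀ Y`
(column-wise) and `w Z = w Y`, then `∑_{a,b} v₀ a · G a b · w b = 0` for `G = Z F Zᵀ`. -/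
theorem chain_orthogonal_of_invariant_form (Z Y : ι → κ → R) (F : κ → κ → R)
    (hF : ∀ a b : ι, ∑ e, ∑ e', Z a e * F e e' * Z b e' = ∑ e, ∑ e', Y a e * F e e' * Y b e')
    (v₀ v₁ w : ι → R)
    (hv₀ : ∀ e : κ, ∑ a, v₀ a * Z a e = ∑ a, v₀ a * Y a e)
    (hv₁ : ∀ e : κ, ∑ a, v₁ a * Z a e - ∑ a, v₁ a * Y a e = -∑ a, v₀ a * Y a e)
    (hw : ∀ e : κ, ∑ a, w a * Z a e = ∑ a, w a * Y a e) :
    ∑ a, ∑ b, v₀ a * (∑ e, ∑ e', Z a e * F e e' * Z b e') * w b = 0 := by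
  -- `v₁ G w` computed through `Z F Zᵀ` and through `Y F Yᵀ`
  have hG : ∑ a, ∑ b, v₁ a * (∑ e, ∑ e', Z a e * F e e' * Z b e') * w b =
      ∑ a, ∑ b, v₁ a * (∑ e, ∑ e', Y a e * F e e' * Y b e') * w b := by
    refine sum_congr rfl fun a _ => sum_congr rfl fun b _ => ?_
    rw [hF a b]
  rw [sum_sum_gram_eq, sum_sum_gram_eq] at hG
  -- replace `w Y` by `w Z` on the right
  have hG' : ∑ e, ∑ e', (∑ a, v₁ a * Z a e) * F e e' * (∑ b, w b * Z b e') =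
      ∑ e, ∑ e', (∑ a, v₁ a * Y a e) * F e e' * (∑ b, w b * Z b e') := by
    rw [hG]
    refine sum_congr rfl fun e _ => sum_congr rfl fun e' _ => ?_
    rw [hw e']
  -- subtract: ∑ (v₁Z − v₁Y)_e F (wZ)_e' = 0, and (v₁Z − v₁Y)_e = −(v₀Y)_e = −(v₀Z)_e
  have key : ∑ e, ∑ e', (∑ a, v₀ a * Z a e) * F e e' * (∑ b, w b * Z b e') = 0 := by
    have h0 : ∑ e, ∑ e', ((∑ a, v₁ a * Z a e) - (∑ a, v₁ a * Y a e)) * F e e' * (∑ b, w b * Z b e') = 0 := by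
      have inner : ∀ e, ∑ e', ((∑ a, v₁ a * Z a e) - (∑ a, v₁ a * Y a e)) * F e e' * (∑ b, w b * Z b e') =
          ∑ e', (∑ a, v₁ a * Z a e) * F e e' * (∑ b, w b * Z b e') - ∑ e', (∑ a, v₁ a * Y a e) * F e e' * (∑ b, w b * Z b e') := by
        intro e
        conv_rhs => rw [← Finset.sum_sub_distrib]
        exact Finset.sum_congr rfl fun e' _ => by ring
      rw [Finset.sum_congr rfl fun e _ => inner e, Finset.sum_sub_distrib, hG', sub_self]
    have h1 : ∑ e, ∑ e', ((∑ a, v₁ a * Z a e) - (∑ a, v₁ a * Y a e)) * F e e' * (∑ b, w b * Z b e') =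
        -∑ e, ∑ e', (∑ a, v₀ a * Z a e) * F e e' * (∑ b, w b * Z b e') := by
      have pt : ∀ e e', ((∑ a, v₁ a * Z a e) - (∑ a, v₁ a * Y a e)) * F e e' * (∑ b, w b * Z b e') =
          -((∑ a, v₀ a * Z a e) * F e e' * (∑ b, w b * Z b e')) := by
        intro e e'
        rw [hv₁ e, ← hv₀ e]
        ring
      simp_rw [pt, Finset.sum_neg_distrib]
    rw [h1, neg_eq_zero] at h0
    exact h0
  rw [sum_sum_gram_eq]
  exact key

/-- **Anisotropy criterion.**  If some invariant kernel `F` makes `v₀` anisotropic (`v₀ G v₀ᵀ ≠ 0`, `G = Z F Zᵀ`), then there is no `v₁`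
completing `v₀` to a left Jordan chain of length two at `−1`. -/
theorem no_chain_of_invariant_form_anisotropic (Z Y : ι → κ → R) (F : κ → κ → R)
    (hF : ∀ a b : ι, ∑ e, ∑ e', Z a e * F e e' * Z b e' = ∑ e, ∑ e', Y a e * F e e' * Y b e')
    (v₀ : ι → R) (hv₀ : ∀ e : κ, ∑ a, v₀ a * Z a e = ∑ a, v₀ a * Y a e)
    (haniso : ∑ a, ∑ b, v₀ a * (∑ e, ∑ e', Z a e * F e e' * Z b e') * v₀ b ≠ 0) (v₁ : ι → R) :
    ¬ (∀ e : κ, ∑ a, v₁ a * Z a e - ∑ a, v₁ a * Y a e = -∑ a, v₀ a * Y a e) :=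
  fun hv₁ => haniso (chain_orthogonal_of_invariant_form Z Y F hF v₀ v₁ v₀ hv₀ hv₁ hv₀)

end OrderedDifferences

end Summit.CriticalPhenomena.PercolationContinuityZ3.Theorems
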